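import Mathlib.Data.Set.Finite.Lattice
import Mathlib.Data.Nat.Nth
import Mathlib.Order.Monotone.Basic
import HarnessLib

/-!
# König for the centre forest (res-L0-w41-strat-2's `koenig_nat`, §σ2.21 delta rev 13 c7828a1d38db410e — Theses-free copy)

W4.1, crux `Steer` (stmt-ResolutionOfSingularities-16345), σ-residual HIGH half, HIGH-WANDER FOREST. Pure combinatorics: a relation
`A` on `ℕ` with `A i j → i < j`, transitive, whose ancestor sets are chains, with infinitely many nodes in a set `S` closed under
ancestors, finitely many roots and finite branching, has an infinite chain. PROVED by res-L0-w41-strat-2 inside the skeleton delta;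
copied here (verbatim up to the namespace) so that the Theses-free THREAD file can use it — the GRADED instance (nodes of one height)
is how `ThreadChain.births_or_branching_of_thread` consumes it. OURS (strat-2). [folklore]
-/

-- `Summit.<S>.<S>.…` duplicates the summit name by design (single-problem summit).
set_option linter.dupNamespace false

namespace Summit.ResolutionOfSingularities.ResolutionOfSingularities.Theorems.SwitchingDichotomy.ThreadChain

/-! ## §4 König for the centre forest (res-L0-w41-strat-2's `koenig_nat`, delta rev 13 c7828a1d38db410e, adapted verbatim) -/

/-- **Abstract König over ℕ-indexed forests** (pure combinatorics; res-L0-w41-strat-2 §σ2.21, copied so that this Theses-free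
file is self-contained): a relation `A` on `ℕ` with `A i j → i < j`, transitive, whose ancestor sets are chains, with infinitely many
nodes in `S` (closed under ancestors), finitely many roots and finite branching has an infinite chain. OURS (strat-2). [folklore] -/
theorem koenig_nat {A : ℕ → ℕ → Prop} {S : Set ℕ}
    (hlt : ∀ {i j}, A i j → i < j) (hSi : ∀ {i j}, A i j → i ∈ S)
    (htrans : ∀ {i j l}, A i j → A j l → A i l)
    (hchain : ∀ {i j l}, i < j → A i l → A j l → A i j)
    (hinf : S.Infinite)
    (hroots : {j | j ∈ S ∧ ∀ i, ¬ A i j}.Finite)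
    (hbr : ∀ i, {j | A i j ∧ ∀ k, A k j → k ≤ i}.Finite) :
    ∃ J : Set ℕ, J.Infinite ∧ ∀ i ∈ J, ∀ j ∈ J, i < j → A i j := by
  classical
  -- step 1: an infinite subtree has a child with an infinite subtree
  have key : ∀ i, {j | A i j}.Infinite → ∃ c, (A i c ∧ ∀ k, A k c → k ≤ i) ∧ {j | A c j}.Infinite := by
    intro i hi
    by_contra hne
    push Not at hne
    apply hi
    have hsub : {j | A i j} ⊆ {j | A i j ∧ ∀ k, A k j → k ≤ i} ∪
        ⋃ c ∈ {j | A i j ∧ ∀ k, A k j → k ≤ i}, {j | A c j} := by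
      intro j hj
      have hex : ∃ k, A i k ∧ (k = j ∨ A k j) := ⟨j, hj, Or.inl rfl⟩
      have hcspec := Nat.find_spec hex
      have hcmin : ∀ k, A i k ∧ (k = j ∨ A k j) → Nat.find hex ≤ k := fun k hk => Nat.find_min' hex hk
      have hchild : A i (Nat.find hex) ∧ ∀ k, A k (Nat.find hex) → k ≤ i := by
        refine ⟨hcspec.1, fun k hk => ?_⟩
        by_contra hki
        push Not at hki
        have hik : A i k := hchain hki hcspec.1 hk
        have hkj : k = j ∨ A k j := by
          rcases hcspec.2 with h | h
          · exact Or.inr (h ▸ hk)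
          · exact Or.inr (htrans hk h)
        exact absurd (hcmin k ⟨hik, hkj⟩) (not_le.mpr (hlt hk))
      rcases hcspec.2 with h | h
      · left
        rw [← h]
        exact hchild
      · right
        exact Set.mem_biUnion hchild h
    exact ((hbr i).union ((hbr i).biUnion fun c hc => hne c hc)).subset hsub
  -- step 2: some node has an infinite subtree
  have hroot : ∃ r, {j | A r j}.Infinite := by
    by_contra hne
    push Not at hne
    apply hinf
    have hsub : S ⊆ {j | j ∈ S ∧ ∀ i, ¬ A i j} ∪ ⋃ r ∈ {j | j ∈ S ∧ ∀ i, ¬ A i j}, {j | A r j} := by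
      intro j hj
      by_cases hex : ∃ i, A i j
      · have hm : A (Nat.find hex) j := Nat.find_spec hex
        have hmroot : Nat.find hex ∈ {j | j ∈ S ∧ ∀ i, ¬ A i j} := by
          refine ⟨hSi hm, fun i him => ?_⟩
          exact absurd (Nat.find_min' hex (htrans him hm)) (not_le.mpr (hlt him))
        exact Or.inr (Set.mem_biUnion hmroot hm)
      · push Not at hex
        exact Or.inl ⟨hj, hex⟩
    exact (hroots.union (hroots.biUnion fun r _ => hne r)).subset hsub
  -- step 3: iterate
  obtain ⟨r, hr⟩ := hroot
  let T := {i : ℕ // {j | A i j}.Infinite}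
  let next : T → T := fun x => ⟨Classical.choose (key x.1 x.2), (Classical.choose_spec (key x.1 x.2)).2⟩
  let f : ℕ → T := fun n => Nat.rec ⟨r, hr⟩ (fun _ x => next x) n
  have hstep : ∀ n, A (f n).1 (f (n + 1)).1 := fun n =>
    (Classical.choose_spec (key (f n).1 (f n).2)).1.1
  have hmono' : ∀ m n, m < n → A (f m).1 (f n).1 := by
    intro m n hmn
    induction n with
    | zero => exact absurd hmn (Nat.not_lt_zero _)
    | succ n ih =>
      rcases Nat.lt_succ_iff_lt_or_eq.mp hmn with h | h
      · exact htrans (ih h) (hstep n)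
      · subst h; exact hstep m
  have hsm : StrictMono (fun n => (f n).1) := strictMono_nat_of_lt_succ fun n => hlt (hstep n)
  refine ⟨Set.range (fun n => (f n).1), Set.infinite_range_of_injective hsm.injective, ?_⟩
  rintro _ ⟨m, rfl⟩ _ ⟨n, rfl⟩ hmn
  exact hmono' m n (hsm.lt_iff_lt.mp hmn)


end Summit.ResolutionOfSingularities.ResolutionOfSingularities.Theorems.SwitchingDichotomy.ThreadChain
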